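import Mathlib
import HarnessLib
import Summits.ResolutionOfSingularities.ResolutionOfSingularities.Theorems.WildQuotientsWildQuotientResolutionZ9PeeledTerminalLift

/-!
# ℤ9 SPECIMEN (peeled `𝔸⁴/ℤ9`, char 3), brick Z4b part 2: the lift on the terminal chart ring EXISTS and
# has order 3

(crux stmt-ResolutionOfSingularities-15640 `WildQuotients.WildQuotientResolution`, line `Sketch`; S1 =
stmt-ResolutionOfSingularities-17941 `CyclicQuotientFourfolds`; chain w45c card-P specimen «peeled 𝔸⁴/ℤ9», variant
V-BR, brick Z4b (res-L1-w45c-plan-1 RULING 2026-08-27T18:23:36Z «Z4b → stub-3»). [OURS · L1 W4.5c] — NOT a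
statement of any manuscript; AI-produced, kernel-checked ≠ expert-reviewed. Def-free, LAW-BASED over the laws of
`…Z9PeeledTerminalLift` (mould: res-L1-w45c-stub-2's Z4T `…Z9PeeledTwistedLiftCube`).)

* `lift_cube_apply_C` — `σ̃²(ι s) = ι s · ι v'`, `σ̃³(ι s) = ι s` (char 3);
* `lift_cube_apply_term` — `σ̃³ = id` on the `ψ₂`-images (`lift_comp_term` + `σ̄³ = 1`);
* **`lift_cube_eq_id`** — `σ̃ ∘ σ̃ ∘ σ̃ = id` on all of `L₂` (cancellation in the domain `L₂`: `x_a′`, `x_b′`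
  from the images `x_a′s⁷`, `x_b′s⁴`; `(v v')⁻¹` from the image `ψ₂(N₂) = s³ v v'`);
* **`exists_terminalLift`** — in characteristic `3`, for the peeled `σ̄` with `σ̄³ = 1`, there is a `k`-algebra
  AUTOMORPHISM `σ̃` of `L₂` with the four laws, passengers fixed, and `σ̃ ^ 3 = 1`
  (`IsLocalization.Away.liftAlgHom` of the substitution; `ψ₀(v v') = v'·iv²` is a unit; inverse `σ̃²`);
* `terminalLift_ne_one` — any lift with the law `σ̃ (ι s) = ι (s v)` is not the identity.
-/

-- single-problem summit: the doubled namespace component `ResolutionOfSingularities` is forced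
set_option linter.dupNamespace false

noncomputable section

open MvPolynomial

namespace Summit.ResolutionOfSingularities.ResolutionOfSingularities.Theorems.WildQuotientResolution.Z9Peeled.Terminal

variable (k : Type) [Field k] (n : ℕ) (a b c d : Fin n)

/-- `v = 1 + s³ x_b′` (slots `s = X c`, `x_b′ = X b`; local shorthand). -/
local notation3 "v₂" => (1 + X c ^ 3 * X b : MvPolynomial (Fin n) k)
/-- `v' = 1 − s³ x_b′ + s⁶ x_a′` (local shorthand). -/
local notation3 "v₂'" => (1 - X c ^ 3 * X b + X c ^ 6 * X a : MvPolynomial (Fin n) k)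
/-- `u₂ = v v'` expanded (local shorthand; the element inverted on the terminal piece). -/
local notation3 "u₂" => ((1 + X c ^ 3 * X b) * (1 - X c ^ 3 * X b + X c ^ 6 * X a) : MvPolynomial (Fin n) k)
/-- The terminal chart ring `L₂ = k[x][(v v')⁻¹]` (local shorthand). -/
local notation3 "L₂" => Localization.Away
  ((1 + X c ^ 3 * X b) * (1 - X c ^ 3 * X b + X c ^ 6 * X a) : MvPolynomial (Fin n) k)
/-- `ι : k[x] → L₂` (local shorthand). -/
local notation3 "ι₂" => algebraMap (MvPolynomial (Fin n) k) (Localization.Away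
  ((1 + X c ^ 3 * X b) * (1 - X c ^ 3 * X b + X c ^ 6 * X a) : MvPolynomial (Fin n) k))
/-- `J = (v v')⁻¹ ∈ L₂` (local shorthand). -/
local notation3 "J₂" => (IsLocalization.Away.invSelf
  ((1 + X c ^ 3 * X b) * (1 - X c ^ 3 * X b + X c ^ 6 * X a) : MvPolynomial (Fin n) k) :
  Localization.Away ((1 + X c ^ 3 * X b) * (1 - X c ^ 3 * X b + X c ^ 6 * X a) : MvPolynomial (Fin n) k))
/-- `iv = (ι v)⁻¹ = ι v' · J` (local shorthand). -/
local notation3 "iv₂" => (algebraMap (MvPolynomial (Fin n) k) (Localization.Away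
  ((1 + X c ^ 3 * X b) * (1 - X c ^ 3 * X b + X c ^ 6 * X a) : MvPolynomial (Fin n) k))
    (1 - X c ^ 3 * X b + X c ^ 6 * X a) *
  (IsLocalization.Away.invSelf
    ((1 + X c ^ 3 * X b) * (1 - X c ^ 3 * X b + X c ^ 6 * X a) : MvPolynomial (Fin n) k) :
    Localization.Away ((1 + X c ^ 3 * X b) * (1 - X c ^ 3 * X b + X c ^ 6 * X a) : MvPolynomial (Fin n) k)))
/-- `iv' = (ι v')⁻¹ = ι v · J` (local shorthand). -/
local notation3 "iv₂'" => (algebraMap (MvPolynomial (Fin n) k) (Localization.Away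
  ((1 + X c ^ 3 * X b) * (1 - X c ^ 3 * X b + X c ^ 6 * X a) : MvPolynomial (Fin n) k))
    (1 + X c ^ 3 * X b) *
  (IsLocalization.Away.invSelf
    ((1 + X c ^ 3 * X b) * (1 - X c ^ 3 * X b + X c ^ 6 * X a) : MvPolynomial (Fin n) k) :
    Localization.Away ((1 + X c ^ 3 * X b) * (1 - X c ^ 3 * X b + X c ^ 6 * X a) : MvPolynomial (Fin n) k)))
/-- The terminal substitution `ψ₂` (local shorthand): `x_a ↦ x_a′ s⁷`, `x_b ↦ x_b′ s⁴`, rest fixed. -/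
local notation3 "tm₂" => (fun i : Fin n => if i = a then X a * X c ^ 7
    else if i = b then X b * X c ^ 4 else (X i : MvPolynomial (Fin n) k))

/-! ## `σ̃³ = 1` -/

set_option maxHeartbeats 1600000 in
/-- `τ² (ι s) = ι s · ι v'` and **`τ³ (ι s) = ι s`** (char 3). [OURS · L1 W4.5c] -/
theorem lift_cube_apply_C [CharP k 3] (τ : L₂ →ₐ[k] L₂)
    (hC : τ (ι₂ (X c)) = ι₂ (X c * v₂)) (hA : τ (ι₂ (X a)) = ι₂ (X a) * iv₂ ^ 7)
    (hB : τ (ι₂ (X b)) = ι₂ (X b + X c ^ 3 * X a) * iv₂ ^ 4) :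
    τ (τ (ι₂ (X c))) = ι₂ (X c) * ι₂ v₂' ∧ τ (τ (τ (ι₂ (X c)))) = ι₂ (X c) := by
  have hJ := algebraMap_v_mul_iv k n a b c
  have hv := lift_apply_v k n a b c τ hC hB
  have hv' := lift_apply_v' k n a b c τ hC hA hB
  rw [map_mul] at hC
  have h2 : τ (τ (ι₂ (X c))) = ι₂ (X c) * ι₂ v₂' := by
    rw [hC, map_mul, hC, hv]
    linear_combination (ι₂ (X c) * ι₂ v₂') * hJ
  refine ⟨h2, ?_⟩
  rw [h2, map_mul, hC, hv']
  linear_combination (ι₂ (X c)) * hJ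

/-- **`τ³ = id` on the `ψ₂`-images**: `τ³ (ι (ψ₂ F)) = ι (ψ₂ F)` (from `lift_comp_term` and `σ̄³ = 1`).
[OURS · L1 W4.5c] -/
theorem lift_cube_apply_term (σ : MvPolynomial (Fin n) k ≃ₐ[k] MvPolynomial (Fin n) k)
    (hb : σ (X b) = X b + X a) (hc : σ (X c) = X c + X b)
    (hd : σ (X d) = X d + X c ^ 3 - X a ^ 2 * X c)
    (hσ : ∀ i, i ≠ b → i ≠ c → i ≠ d → σ (X i) = X i) (hσ3 : σ ^ 3 = 1)
    (hab : a ≠ b) (hac : a ≠ c) (had : a ≠ d) (hbc : b ≠ c) (hbd : b ≠ d)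
    (τ : L₂ →ₐ[k] L₂)
    (hC : τ (ι₂ (X c)) = ι₂ (X c * v₂)) (hA : τ (ι₂ (X a)) = ι₂ (X a) * iv₂ ^ 7)
    (hB : τ (ι₂ (X b)) = ι₂ (X b + X c ^ 3 * X a) * iv₂ ^ 4)
    (hD : τ (ι₂ (X d)) = ι₂ (X d + X c ^ 3 - X c ^ 15 * X a ^ 2))
    (hfix : ∀ i, i ≠ a → i ≠ b → i ≠ c → i ≠ d → τ (ι₂ (X i)) = ι₂ (X i))
    (F : MvPolynomial (Fin n) k) :
    τ (τ (τ (ι₂ (aeval tm₂ F)))) = ι₂ (aeval tm₂ F) := by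
  have h := fun F => lift_comp_term k n a b c d σ hb hc hd hσ hab hac had hbc hbd τ hC hA hB hD hfix F
  rw [h, h, h, ← AlgEquiv.mul_apply, ← AlgEquiv.mul_apply, ← pow_two, ← pow_succ, hσ3,
    AlgEquiv.one_apply]

/-- `v v' ≠ 0` in `k[x]` (constant coefficient `1`). [folklore] -/
theorem u₂_ne_zero : u₂ ≠ 0 := by
  classical
  intro h
  have h' := congrArg MvPolynomial.constantCoeff h
  simp [MvPolynomial.constantCoeff_X] at h'

/-- `ι : k[x] → L₂` is injective (`k[x]` is a domain, `v v' ≠ 0`). [folklore] -/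
theorem algebraMap_L₂_injective : Function.Injective ι₂ :=
  IsLocalization.injective _ (powers_le_nonZeroDivisors_of_noZeroDivisors (u₂_ne_zero k n a b c))

/-- `L₂` is a domain. [folklore] -/
theorem isDomain_L₂ : IsDomain L₂ :=
  IsLocalization.isDomain_of_le_nonZeroDivisors _
    (powers_le_nonZeroDivisors_of_noZeroDivisors (u₂_ne_zero k n a b c))

set_option maxHeartbeats 1600000 in
/-- **`τ³ = id` on all of `L₂`** (char 3, `σ̄³ = 1`): `τ³` fixes `ι s` (`lift_cube_apply_C`), hence `ι x_a′`,
`ι x_b′` (from the `ψ₂`-images `x_a′ s⁷`, `x_b′ s⁴` and cancellation in the domain `L₂`), `ι (v v')` (from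
`ψ₂ (N₂) = s³ v v'`), `ι x_d` and the passengers (`ψ₂`-images), and `J = (v v')⁻¹` (inverses are unique); so
`τ ∘ τ ∘ τ = id` by `IsLocalization.ringHom_ext`. [OURS · L1 W4.5c] -/
theorem lift_cube_eq_id [CharP k 3] (σ : MvPolynomial (Fin n) k ≃ₐ[k] MvPolynomial (Fin n) k)
    (hb : σ (X b) = X b + X a) (hc : σ (X c) = X c + X b)
    (hd : σ (X d) = X d + X c ^ 3 - X a ^ 2 * X c)
    (hσ : ∀ i, i ≠ b → i ≠ c → i ≠ d → σ (X i) = X i) (hσ3 : σ ^ 3 = 1)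
    (hab : a ≠ b) (hac : a ≠ c) (had : a ≠ d) (hbc : b ≠ c) (hbd : b ≠ d)
    (τ : L₂ →ₐ[k] L₂)
    (hC : τ (ι₂ (X c)) = ι₂ (X c * v₂)) (hA : τ (ι₂ (X a)) = ι₂ (X a) * iv₂ ^ 7)
    (hB : τ (ι₂ (X b)) = ι₂ (X b + X c ^ 3 * X a) * iv₂ ^ 4)
    (hD : τ (ι₂ (X d)) = ι₂ (X d + X c ^ 3 - X c ^ 15 * X a ^ 2))
    (hfix : ∀ i, i ≠ a → i ≠ b → i ≠ c → i ≠ d → τ (ι₂ (X i)) = ι₂ (X i)) :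
    τ.comp (τ.comp τ) = AlgHom.id k L₂ := by
  classical
  haveI : IsDomain L₂ := isDomain_L₂ k n a b c
  have hinj := algebraMap_L₂_injective k n a b c
  have hC0 : ι₂ (X c) ≠ 0 := fun h => X_ne_zero c (hinj (by rw [h, map_zero]))
  have hcube := fun F => lift_cube_apply_term k n a b c d σ hb hc hd hσ hσ3 hab hac had hbc hbd τ hC hA hB
    hD hfix F
  have h3C := (lift_cube_apply_C k n a b c τ hC hA hB).2
  -- `τ³ (ι x_a′) = ι x_a′` from the image `x_a′ s⁷ = ψ₂ (x_a)`
  have h3A : τ (τ (τ (ι₂ (X a)))) = ι₂ (X a) := by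
    have h := hcube (X a)
    rw [term_X_a] at h
    simp only [map_mul, map_pow] at h
    rw [h3C] at h
    have h' : ι₂ (X c) ^ 7 * τ (τ (τ (ι₂ (X a)))) = ι₂ (X c) ^ 7 * ι₂ (X a) := by
      linear_combination h
    exact mul_left_cancel₀ (pow_ne_zero 7 hC0) h'
  -- `τ³ (ι x_b′) = ι x_b′` from the image `x_b′ s⁴ = ψ₂ (x_b)`
  have h3B : τ (τ (τ (ι₂ (X b)))) = ι₂ (X b) := by
    have h := hcube (X b)
    rw [term_X_b k n a b c hab] at h
    simp only [map_mul, map_pow] at h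
    rw [h3C] at h
    have h' : ι₂ (X c) ^ 4 * τ (τ (τ (ι₂ (X b)))) = ι₂ (X c) ^ 4 * ι₂ (X b) := by
      linear_combination h
    exact mul_left_cancel₀ (pow_ne_zero 4 hC0) h'
  -- `τ³ (ι v) · τ³ (ι v') = ι v · ι v'` from the image `s³ v v' = ψ₂ (N₂)`
  have h3U : τ (τ (τ (ι₂ v₂))) * τ (τ (τ (ι₂ v₂'))) = ι₂ v₂ * ι₂ v₂' := by
    have h := hcube (X c * (X c + X b) * (X c - X b + X a))
    rw [term_N2 k n a b c hab hac hbc] at h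
    simp only [map_mul, map_pow] at h
    rw [h3C] at h
    exact mul_left_cancel₀ (pow_ne_zero 3 hC0) h
  -- `τ³ J = J`
  have h3J : τ (τ (τ J₂)) = J₂ := by
    have h1 := algebraMap_u_mul_J k n a b c
    rw [algebraMap_u_eq] at h1
    have h := congrArg (fun y => τ (τ (τ y))) h1
    simp only [map_mul, map_one] at h
    rw [h3U] at h
    linear_combination J₂ * h - (τ (τ (τ J₂))) * h1
  -- assemble
  apply AlgHom.coe_ringHom_injective
  refine IsLocalization.ringHom_ext (Submonoid.powers u₂) ?_
  refine MvPolynomial.ringHom_ext (fun r => ?_) (fun i => ?_)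
  · change τ (τ (τ (ι₂ (C r)))) = ι₂ (C r)
    have h : ι₂ (C r) = algebraMap k L₂ r := by
      rw [← MvPolynomial.algebraMap_eq]
      exact (IsScalarTower.algebraMap_apply k (MvPolynomial (Fin n) k) L₂ r).symm
    rw [h, AlgHom.commutes, AlgHom.commutes, AlgHom.commutes]
  · change τ (τ (τ (ι₂ (X i)))) = ι₂ (X i)
    by_cases hia : i = a
    · rw [hia]; exact h3A
    by_cases hib : i = b
    · rw [hib]; exact h3B
    by_cases hic : i = c
    · rw [hic]; exact h3C
    by_cases hid : i = d
    · have h := hcube (X d)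
      rw [term_X_of_ne k n a b c had.symm hbd.symm] at h
      rw [hid]
      exact h
    · rw [hfix i hia hib hic hid, hfix i hia hib hic hid, hfix i hia hib hic hid]

/-! ## Existence of the lift -/

-- the unit computation and the cube run over the long law binders; head-room
set_option maxHeartbeats 1600000 in
/-- **The terminal lift exists**: in characteristic `3`, for the peeled `σ̄` with `σ̄³ = 1` there is a
`k`-algebra automorphism `σ̃` of the terminal chart ring `L₂ = k[x][(v v')⁻¹]` with the laws
`σ̃ (ι s) = ι (s v)`, `σ̃ (ι x_a′) = ι x_a′ · iv⁷`, `σ̃ (ι x_b′) = ι (x_b′ + s³x_a′) · iv⁴`,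
`σ̃ (ι x_d) = ι (x_d + s³ − s¹⁵ x_a′²)`, passengers fixed, and `σ̃ ^ 3 = 1` (construction:
`IsLocalization.Away.liftAlgHom` of the substitution — `ψ₀(v v') = v'·iv²` is a unit — inverted by its own
square, `lift_cube_eq_id`). [OURS · L1 W4.5c] -/
theorem exists_terminalLift [CharP k 3] (σ : MvPolynomial (Fin n) k ≃ₐ[k] MvPolynomial (Fin n) k)
    (hb : σ (X b) = X b + X a) (hc : σ (X c) = X c + X b)
    (hd : σ (X d) = X d + X c ^ 3 - X a ^ 2 * X c)
    (hσ : ∀ i, i ≠ b → i ≠ c → i ≠ d → σ (X i) = X i) (hσ3 : σ ^ 3 = 1)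
    (hab : a ≠ b) (hac : a ≠ c) (had : a ≠ d) (hbc : b ≠ c) (hbd : b ≠ d) (hcd : c ≠ d) :
    ∃ σt : L₂ ≃ₐ[k] L₂,
      σt (ι₂ (X c)) = ι₂ (X c * v₂) ∧ σt (ι₂ (X a)) = ι₂ (X a) * iv₂ ^ 7 ∧
      σt (ι₂ (X b)) = ι₂ (X b + X c ^ 3 * X a) * iv₂ ^ 4 ∧
      σt (ι₂ (X d)) = ι₂ (X d + X c ^ 3 - X c ^ 15 * X a ^ 2) ∧
      (∀ i, i ≠ a → i ≠ b → i ≠ c → i ≠ d → σt (ι₂ (X i)) = ι₂ (X i)) ∧ σt ^ 3 = 1 := by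
  classical
  have hJ := algebraMap_v_mul_iv k n a b c
  have h2 := algebraMap_v'_mul_iv' k n a b c
  -- the substitution `ψ₀ : k[x] → L₂`
  let φ₀ : MvPolynomial (Fin n) k →ₐ[k] L₂ := aeval (fun i : Fin n =>
    if i = c then ι₂ (X c * v₂) else if i = a then ι₂ (X a) * iv₂ ^ 7
    else if i = b then ι₂ (X b + X c ^ 3 * X a) * iv₂ ^ 4
    else if i = d then ι₂ (X d + X c ^ 3 - X c ^ 15 * X a ^ 2)
    else ι₂ (X i))
  have hφc : φ₀ (X c) = ι₂ (X c * v₂) := by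
    change aeval _ (X c) = _; rw [aeval_X]; simp
  have hφa : φ₀ (X a) = ι₂ (X a) * iv₂ ^ 7 := by
    change aeval _ (X a) = _; rw [aeval_X]; simp [hac]
  have hφb : φ₀ (X b) = ι₂ (X b + X c ^ 3 * X a) * iv₂ ^ 4 := by
    change aeval _ (X b) = _; rw [aeval_X]; simp [hbc, hab.symm]
  have hφd : φ₀ (X d) = ι₂ (X d + X c ^ 3 - X c ^ 15 * X a ^ 2) := by
    change aeval _ (X d) = _; rw [aeval_X]; simp [hcd.symm, had.symm, hbd.symm]
  have hφi : ∀ i, i ≠ a → i ≠ b → i ≠ c → i ≠ d → φ₀ (X i) = ι₂ (X i) := by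
    intro i h1 h2' h3' h4
    change aeval _ (X i) = _; rw [aeval_X]; simp [h1, h2', h3', h4]
  -- `ψ₀ (v v') = v'·iv²` is a unit
  have hφv : φ₀ v₂ = ι₂ v₂' * iv₂ := by
    have e : φ₀ v₂ = 1 + φ₀ (X c) ^ 3 * φ₀ (X b) := by
      rw [map_add, map_one, map_mul, map_pow]
    rw [e, hφc, hφb, map_mul]
    exact v_identity k n a b c
  have hφv' : φ₀ v₂' = iv₂ := by
    have e : φ₀ v₂' = 1 - φ₀ (X c) ^ 3 * φ₀ (X b) + φ₀ (X c) ^ 6 * φ₀ (X a) := by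
      rw [map_add, map_sub, map_one, map_mul, map_pow, map_mul, map_pow]
    rw [e, hφc, hφb, hφa, map_mul]
    exact v'_identity k n a b c
  have hφu : φ₀ u₂ = ι₂ v₂' * iv₂ ^ 2 := by
    rw [map_mul, hφv, hφv']; ring
  have hiv : IsUnit iv₂ := IsUnit.of_mul_eq_one_right (ι₂ v₂) hJ
  have hv'u : IsUnit (ι₂ v₂') := IsUnit.of_mul_eq_one iv₂' h2
  have hunit : IsUnit (φ₀ u₂) := by rw [hφu]; exact hv'u.mul (hiv.pow 2)
  -- the lift to `L₂`
  let τ₀ : L₂ →ₐ[k] L₂ := IsLocalization.Away.liftAlgHom (S := L₂) u₂ (f := φ₀) hunit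
  have hτ₀ : ∀ r, τ₀ (ι₂ r) = φ₀ r := fun r => by
    change IsLocalization.Away.liftAlgHom u₂ hunit (ι₂ r) = φ₀ r
    rw [IsLocalization.Away.liftAlgHom_apply, IsLocalization.Away.lift_eq]
    rfl
  have hC : τ₀ (ι₂ (X c)) = ι₂ (X c * v₂) := by rw [hτ₀, hφc]
  have hA : τ₀ (ι₂ (X a)) = ι₂ (X a) * iv₂ ^ 7 := by rw [hτ₀, hφa]
  have hB : τ₀ (ι₂ (X b)) = ι₂ (X b + X c ^ 3 * X a) * iv₂ ^ 4 := by rw [hτ₀, hφb]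
  have hD : τ₀ (ι₂ (X d)) = ι₂ (X d + X c ^ 3 - X c ^ 15 * X a ^ 2) := by rw [hτ₀, hφd]
  have hfix : ∀ i, i ≠ a → i ≠ b → i ≠ c → i ≠ d → τ₀ (ι₂ (X i)) = ι₂ (X i) := by
    intro i h1 h2' h3' h4; rw [hτ₀, hφi i h1 h2' h3' h4]
  -- `τ₀³ = id`, so `τ₀` is invertible
  have hcube := lift_cube_eq_id k n a b c d σ hb hc hd hσ hσ3 hab hac had hbc hbd τ₀ hC hA hB hD hfix
  have hcube' : (τ₀.comp τ₀).comp τ₀ = AlgHom.id k L₂ := by rw [AlgHom.comp_assoc]; exact hcube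
  let σt : L₂ ≃ₐ[k] L₂ := AlgEquiv.ofAlgHom τ₀ (τ₀.comp τ₀) hcube hcube'
  have hσt : ∀ x, σt x = τ₀ x := fun x => rfl
  refine ⟨σt, ?_, ?_, ?_, ?_, ?_, ?_⟩
  · rw [hσt]; exact hC
  · rw [hσt]; exact hA
  · rw [hσt]; exact hB
  · rw [hσt]; exact hD
  · intro i h1 h2' h3' h4; rw [hσt]; exact hfix i h1 h2' h3' h4
  · ext x
    rw [pow_succ σt 2, pow_two σt, AlgEquiv.mul_apply, AlgEquiv.mul_apply, AlgEquiv.one_apply, hσt,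
      hσt, hσt]
    exact DFunLike.congr_fun hcube x

/-- Any lift with the law `σ̃ (ι s) = ι (s v)` is **not the identity** (`ι` is injective and
`s v − s = s⁴ x_b′ ≠ 0`). [OURS · L1 W4.5c] -/
theorem terminalLift_ne_one (σt : L₂ ≃ₐ[k] L₂) (hC : σt (ι₂ (X c)) = ι₂ (X c * v₂)) :
    σt ≠ 1 := by
  classical
  intro h
  rw [h, AlgEquiv.one_apply] at hC
  have hinj := algebraMap_L₂_injective k n a b c
  have h1 : (X c : MvPolynomial (Fin n) k) = X c * v₂ := hinj hC
  have h2 : (X c ^ 4 * X b : MvPolynomial (Fin n) k) = 0 := by linear_combination -h1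
  exact (mul_ne_zero (pow_ne_zero 4 (X_ne_zero c)) (X_ne_zero b)) h2

end Summit.ResolutionOfSingularities.ResolutionOfSingularities.Theorems.WildQuotientResolution.Z9Peeled.Terminal

end
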